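import Literature.NumberTheory.EllipticCurves.RationalTorsionKernelOfReductionCriterion
import Literature.NumberTheory.EllipticCurves.Isogeny
import HarnessLib

set_option linter.dupNamespace false -- `…BirchSwinnertonDyer.BirchSwinnertonDyer…` is the cell's nested layout (D-0017)
set_option autoImplicit false

/-!
# Route `TwoAdicConverse` (rung S3), item 19218: the displayed class-level hypothesis (ISO-T₁)∣(β) as a per-curve `Prop`

Cell `bsd-2adic` (run/shared/lean/pub/bsd-2adic/), seat `bsd-2adic-tower-1` GEN 37; route-posited object of route `TwoAdicConverse`
(pen RC-513 / director-bsd g20 key «`IsoT1AtTwo` def (Theorems-side, displayed class-level Prop)»).  ONE DEFINITION WITH BODY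
(`IsoT1AtTwo`, a predicate on a Weierstrass curve — NOT a named fact: its universal closure is a theorem of the sibling
`…TwoAdicConverseIsoT1OfMazurKenku` modulo Mazur–Kenku, not an assertion) and its `Iff.rfl` unfolding.  Nothing is asserted, nothing is
booked; item 19218 stays OPEN; BSD is not proved by any of this.

`IsoT1AtTwo W` is VERBATIM the `∃`-body of the hypothesis `hISO` of
`TwoAdicEulerCharKernel.goodOrdinaryRankZeroTwoConverse_of_ordLambdaHalfAtTwo_of_isoT1` (p749231): «`W` is `ℚ`-isogenous to a globally
minimal elliptic `W'` such that, at a place `v₂ ∋ 2`, no non-zero rational point of `W'` whose image in `E'(ℚ̄)` is `2`-power torsion maps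
into the kernel of reduction `E'₁(ℚ̄₂)`» — Greenberg's hypothesis (T₁) «`E(ℚ)[p^∞] ∩ E₁(ℚ_p) = 0`» of LNM 1716 Thm. 4.1 at `p = 2`, asked of
SOME member of the isogeny class (both sides of the rank-`0` `2`-converse are isogeny invariants).

References: [GreenbergLNM1716] Thm. 4.1 (p. 102), §5 p. 123; [SilvermanAEC2009] VII.2.1–2.2, VIII.§1.
-/

noncomputable section

open scoped Classical NumberField

open NumberField IsDedekindDomain WeierstrassCurve Literature.NumberTheory.EllipticCurves

namespace Summit.BirchSwinnertonDyer.BirchSwinnertonDyer.Theorems.TwoAdicEulerCharKernel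

/-- **(ISO-T₁) at `2` for the curve `W`** — the per-curve form of the class-level hypothesis (ISO-T₁)∣(β) of route `TwoAdicConverse`
(p749231's `hISO`): there are a globally minimal elliptic `W'` over `ℚ`, `ℚ`-ISOGENOUS to `W`, and a finite place `v₂ ∋ 2` such that every
rational point `P ∈ W'(ℚ)` whose image in `E'(ℚ̄)` is `2`-power torsion and maps into the kernel of reduction
`W'.localKernelOfReduction v₂ = E'₁(ℚ̄₂)` is `0` — Greenberg's (T₁) «`E'(ℚ)[2^∞] ∩ E'₁ = 0`» (LNM 1716, proof of Thm. 4.1) at SOME member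
of the isogeny class.  A predicate (definition with body); its universal closure on non-CM good-ordinary-at-`2` curves is the theorem
`IsoT1.isoT1AtTwo_of_not_hasCM` (modulo Mazur–Kenku), not asserted here.
[cite: GreenbergLNM1716, Thm. 4.1 (p. 102) and §5 p. 123] [cite: SilvermanAEC2009, Prop. VII.2.1–2.2] -/
def IsoT1AtTwo (W : WeierstrassCurve ℚ) : Prop :=
  ∃ (W' : WeierstrassCurve ℚ) (_ : W'.IsElliptic) (_ : W'.IsGloballyMinimal) (v2 : HeightOneSpectrum (𝓞 ℚ)),
    ((2 : ℕ) : 𝓞 ℚ) ∈ v2.asIdeal ∧ IsIsogenous W W' ∧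
    ∀ P : W'.toAffine.Point, (∃ t : ℕ, 2 ^ t • toGeomPoints W' P = 0) →
      pointsMap W' (v2.adicCompletion ℚ) (toGeomPoints W' P) ∈ W'.localKernelOfReduction v2 → P = 0

/-- Unfolding `IsoT1AtTwo` (`Iff.rfl`). [cite: GreenbergLNM1716, Thm. 4.1 (p. 102)] -/
theorem isoT1AtTwo_iff (W : WeierstrassCurve ℚ) :
    IsoT1AtTwo W ↔
      ∃ (W' : WeierstrassCurve ℚ) (_ : W'.IsElliptic) (_ : W'.IsGloballyMinimal) (v2 : HeightOneSpectrum (𝓞 ℚ)),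
        ((2 : ℕ) : 𝓞 ℚ) ∈ v2.asIdeal ∧ IsIsogenous W W' ∧
        ∀ P : W'.toAffine.Point, (∃ t : ℕ, 2 ^ t • toGeomPoints W' P = 0) →
          pointsMap W' (v2.adicCompletion ℚ) (toGeomPoints W' P) ∈ W'.localKernelOfReduction v2 → P = 0 :=
  Iff.rfl

end Summit.BirchSwinnertonDyer.BirchSwinnertonDyer.Theorems.TwoAdicEulerCharKernel

end
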